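import Summits.PneNP.PneNP.Theorems.SymmetryBudgetNoHiddenOrderProgramGates
import Summits.PneNP.PneNP.Theorems.SymmetryBudgetNoHiddenOrderFLabCard

/-!
# `NoHiddenOrder` (stmt-PneNP-14781), (R2c) VI: the window canoniser program — the relabelling action on the gate type

Route `PneNP/SymmetryBudget`; companion of `…ProgramGates.lean` (seat -1's gate type `WCanon.Gt m`).  The symmetry data `θ ρ` of the
window canoniser program is pure bookkeeping on the INDEX DATA of the gates: a budget permutation `ρ` of `Fin m` preserves the window
(`WCanon.budgetPerm ρ hρ : Equiv.Perm (WV m)`), and acts on every gate by relabelling its window-vertex parameters (`u ↦ σ u`), its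
candidates (`κ ↦ (σ κ.1, κ.2)`), its part blocks (`U' ↦ U'.map σ`), its labels (`L ↦ FLab.relabel σ L`) and its ordered indices
(`b ↦ ρ b`), keeping every numeric index (rounds, colours, thresholds, bit positions, output positions) fixed.  This file defines that
action shape by shape (`RIGate.relabel`, `VSGate.relabel`, `VOGate.relabel`, `VAGate.relabel`, `AnGate.relabel`, `TrGate.relabel`,
`OrGate.relabel`, `AndGate.relabel`, `Gt.relabel`), proves that relabelling by `σ⁻¹` undoes relabelling by `σ` (`…relabel_symm_relabel`),
and packages the action on the gate type as a permutation `WCanon.Gt.perm ρ σ : Equiv.Perm (Gt m)` (the `θ ρ` of `SymProg.IsSym`, with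
`σ := budgetPerm ρ hρ`).  Conventions at the three places where a choice is made: `adjO u b ↦ adjO (σ u) (ρ b)`,
`woc a b u c ↦ woc a (ρ b) (σ u) c` (the output row position `a` is fixed), `out q ↦ out q` (outputs are fixed, as `GraphProgram.out_fixed`
demands).  Sorry-free; supports stmt-PneNP-14781, does not close it.
-/

set_option linter.dupNamespace false -- `Summit.PneNP.PneNP.…` (D-0017 single-conjunct layout)

namespace Summit.PneNP.PneNP.Theorems

open Finset

namespace WCanon

variable {m : ℕ}

/-! ### Finset and candidate relabelling -/

/-- Relabelling a candidate `κ = (vertex, value)`: the vertex moves, the value is fixed. [folklore] -/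
def cκ (σ : Equiv.Perm (WV m)) (κ : WV m × Fin (wn m)) : WV m × Fin (wn m) := (σ κ.1, κ.2)

/-- Relabelling a candidate by `σ⁻¹` undoes relabelling by `σ`. [folklore] -/
@[simp] theorem cκ_symm_cκ (σ : Equiv.Perm (WV m)) (κ : WV m × Fin (wn m)) : cκ σ.symm (cκ σ κ) = κ := by
  simp [cκ]

/-- Relabelling a candidate by `σ` undoes relabelling by `σ⁻¹`. [folklore] -/
@[simp] theorem cκ_cκ_symm (σ : Equiv.Perm (WV m)) (κ : WV m × Fin (wn m)) : cκ σ (cκ σ.symm κ) = κ := by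
  simp [cκ]

/-- Relabelling a part block. [folklore] -/
def fs (σ : Equiv.Perm (WV m)) (U : Finset (WV m)) : Finset (WV m) := U.map σ.toEmbedding

/-- Mapping a finset along `σ` and back. [folklore] -/
theorem map_symm_map {α β : Type*} (σ : α ≃ β) (U : Finset α) : (U.map σ.toEmbedding).map σ.symm.toEmbedding = U := by
  rw [Finset.map_map, ← Equiv.trans_toEmbedding, Equiv.self_trans_symm, Equiv.refl_toEmbedding, Finset.map_refl]

/-- Relabelling a part block by `σ⁻¹` undoes relabelling by `σ`. [folklore] -/
@[simp] theorem fs_symm_fs (σ : Equiv.Perm (WV m)) (U : Finset (WV m)) : fs σ.symm (fs σ U) = U := map_symm_map σ U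

/-- Relabelling a part block by `σ` undoes relabelling by `σ⁻¹`. [folklore] -/
@[simp] theorem fs_fs_symm (σ : Equiv.Perm (WV m)) (U : Finset (WV m)) : fs σ (fs σ.symm U) = U := by
  have h := map_symm_map σ.symm U
  rw [Equiv.symm_symm] at h
  exact h

/-- Membership in a relabelled part block. [folklore] -/
theorem mem_fs_iff (σ : Equiv.Perm (WV m)) (U : Finset (WV m)) (v : WV m) : v ∈ fs σ U ↔ σ.symm v ∈ U := by
  unfold fs; exact Finset.mem_map_equiv

/-- The image form of a relabelled part block. [folklore] -/
theorem fs_eq_image (σ : Equiv.Perm (WV m)) (U : Finset (WV m)) : fs σ U = U.image σ := by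
  unfold fs; exact Finset.map_eq_image _ _

/-- Relabelling an admissible label by `σ⁻¹` undoes relabelling by `σ`. [folklore] -/
@[simp] theorem FLab.relabel_symm_relabel (σ : Equiv.Perm (WV m)) (L : FLab m) : FLab.relabel σ.symm (FLab.relabel σ L) = L :=
  Subtype.ext (FLab.relabelRaw_symm_relabelRaw σ L.1)

/-- Relabelling an admissible label by `σ` undoes relabelling by `σ⁻¹`. [folklore] -/
@[simp] theorem FLab.relabel_relabel_symm (σ : Equiv.Perm (WV m)) (L : FLab m) : FLab.relabel σ (FLab.relabel σ.symm L) = L := by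
  simpa using FLab.relabel_symm_relabel σ.symm L

/-! ### The action on the gate shapes -/

/-- Relabelling a refinement shape. [folklore] -/
def RIGate.relabel (σ : Equiv.Perm (WV m)) : RIGate m → RIGate m
  | .c r u w y => .c r (σ u) (σ w) (σ y)
  | .cmp r u v w g => .cmp r (σ u) (σ v) (σ w) g
  | .nmem w => .nmem (σ w)
  | .nlt r w' w => .nlt r (σ w') (σ w)
  | .pre r u v w w' => .pre r (σ u) (σ v) (σ w) (σ w')
  | .allpre r u v w => .allpre r (σ u) (σ v) (σ w)
  | .wit r u v w => .wit r (σ u) (σ v) (σ w)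
  | .prof r u v => .prof r (σ u) (σ v)
  | .tie r u v => .tie r (σ u) (σ v)
  | .ltS r u v => .ltS r (σ u) (σ v)
  | .eqS r u v => .eqS r (σ u) (σ v)
  | .vc w v => .vc (σ w) (σ v)
  | .vge v t => .vge (σ v) t
  | .vnge v t => .vnge (σ v) t
  | .vinA v t => .vinA (σ v) t
  | .vnm v => .vnm (σ v)
  | .vval v t => .vval (σ v) t

/-- Relabelling the signature comparison shape (coordinates fixed). [folklore] -/
def VSGate.relabel (σ : Equiv.Perm (WV m)) : VSGate m → VSGate m
  | .both k k' j => .both (σ k) (σ k') j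
  | .none k k' j => .none (σ k) (σ k') j
  | .eqv k k' j => .eqv (σ k) (σ k') j
  | .nb k j => .nb (σ k) j
  | .lt k k' j => .lt (σ k) (σ k') j
  | .less k k' => .less (σ k) (σ k')
  | .eqall k k' => .eqall (σ k) (σ k')

/-- Relabelling the candidates' comparison shape. [folklore] -/
def VOGate.relabel (σ : Equiv.Perm (WV m)) : VOGate m → VOGate m
  | .both k k' j => .both (cκ σ k) (cκ σ k') j
  | .none k k' j => .none (cκ σ k) (cκ σ k') j
  | .eqv k k' j => .eqv (cκ σ k) (cκ σ k') j
  | .nb k j => .nb (cκ σ k) j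
  | .lt k k' j => .lt (cκ σ k) (cκ σ k') j
  | .less k k' => .less (cκ σ k) (cκ σ k')
  | .eqall k k' => .eqall (cκ σ k) (cκ σ k')

/-- Relabelling the parts' comparison shape. [folklore] -/
def VAGate.relabel (σ : Equiv.Perm (WV m)) : VAGate m → VAGate m
  | .both k k' j => .both (fs σ k) (fs σ k') j
  | .none k k' j => .none (fs σ k) (fs σ k') j
  | .eqv k k' j => .eqv (fs σ k) (fs σ k') j
  | .nb k j => .nb (fs σ k) j
  | .lt k k' j => .lt (fs σ k) (fs σ k') j
  | .less k k' => .less (fs σ k) (fs σ k')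
  | .eqall k k' => .eqall (fs σ k) (fs σ k')

/-- Relabelling an analysis shape. [folklore] -/
def AnGate.relabel (σ : Equiv.Perm (WV m)) : AnGate m → AnGate m
  | .oPr u v c c' => .oPr (σ u) (σ v) c c'
  | .oLt u v => .oLt (σ u) (σ v)
  | .oEq u v => .oEq (σ u) (σ v)
  | .swPr u v a b => .swPr (σ u) (σ v) (σ a) (σ b)
  | .swApr u v a b => .swApr (σ u) (σ v) (σ a) (σ b)
  | .swTw u v g => .swTw (σ u) (σ v) g
  | .swNadj u v => .swNadj (σ u) (σ v)
  | .swNtw u v => .swNtw (σ u) (σ v)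
  | .swKept u v => .swKept (σ u) (σ v)
  | .swAdded u v => .swAdded (σ u) (σ v)
  | .swSw' u v => .swSw' (σ u) (σ v)
  | .swSw u v => .swSw (σ u) (σ v)
  | .rE u v => .rE (σ u) (σ v)
  | .rMid i u w v => .rMid i (σ u) (σ w) (σ v)
  | .rR i u v => .rR i (σ u) (σ v)
  | .mcCy u y => .mcCy (σ u) (σ y)
  | .mcBig u => .mcBig (σ u)
  | .mcCmp v u g => .mcCmp (σ v) (σ u) g
  | .mcTieLT v u => .mcTieLT (σ v) (σ u)
  | .mcBo v u => .mcBo (σ v) (σ u)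
  | .mcBetter v u => .mcBetter (σ v) (σ u)
  | .mcNobetter u => .mcNobetter (σ u)
  | .mcSel u => .mcSel (σ u)
  | .nmem v => .nmem (σ v)
  | .ncons v => .ncons (σ v)
  | .cov u w => .cov (σ u) (σ w)
  | .all u => .all (σ u)
  | .nall u => .nall (σ u)
  | .disc u => .disc (σ u)
  | .isAND => .isAND
  | .nisAND => .nisAND
  | .big2 => .big2
  | .nbig2 => .nbig2
  | .isOR => .isOR
  | .stop => .stop
  | .frozen => .frozen
  | .nfrozen => .nfrozen
  | .cand y => .cand (σ y)
  | .ncand y => .ncand (σ y)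
  | .dom y => .dom (σ y)
  | .ndom y => .ndom (σ y)
  | .go => .go
  | .ngo => .ngo
  | .andok => .andok
  | .nandok => .nandok

/-- Relabelling a transition shape. [folklore] -/
def TrGate.relabel (σ : Equiv.Perm (WV m)) : TrGate m → TrGate m
  | .tieD u v => .tieD (σ u) (σ v)
  | .ltI u v => .ltI (σ u) (σ v)
  | .bothD u v => .bothD (σ u) (σ v)
  | .noneD u v => .noneD (σ u) (σ v)
  | .deqv u v => .deqv (σ u) (σ v)
  | .eqI u v => .eqI (σ u) (σ v)
  | .rv g => .rv (g.relabel σ)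
  | .takeAnd => .takeAnd
  | .ntakeAnd => .ntakeAnd
  | .takeOr => .takeOr
  | .ntakeOr => .ntakeOr
  | .newMem w => .newMem (σ w)
  | .m1 v => .m1 (σ v)
  | .m2 v => .m2 (σ v)
  | .mx v => .mx (σ v)
  | .v1 v c => .v1 (σ v) c
  | .v2 v c => .v2 (σ v) c
  | .vx v c => .vx (σ v) c
  | .c1 v => .c1 (σ v)
  | .cx v => .cx (σ v)
  | .d1 => .d1
  | .d2 => .d2
  | .d3 => .d3
  | .dx => .dx

/-- Relabelling an individualisation-node shape. [folklore] -/
def OrGate.relabel (σ : Equiv.Perm (WV m)) : OrGate m → OrGate m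
  | .ltx y u v => .ltx (σ y) (σ u) (σ v)
  | .eqx y u v => .eqx (σ y) (σ u) (σ v)
  | .rv y g => .rv (σ y) (g.relabel σ)
  | .bothc κ w c => .bothc (cκ σ κ) (σ w) c
  | .nonec κ w c => .nonec (cκ σ κ) (σ w) c
  | .xnc κ w c => .xnc (cκ σ κ) (σ w) c
  | .eqc κ => .eqc (cκ σ κ)
  | .kept κ => .kept (cκ σ κ)
  | .cmu y c' c u => .cmu (σ y) c' c (σ u)
  | .cm y c' c => .cm (σ y) c' c
  | .lc κ i c' c => .lc (cκ σ κ) i c' c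
  | .liftC κ i c => .liftC (cκ σ κ) i c
  | .vc g => .vc (g.relabel σ)
  | .beat κ' κ => .beat (cκ σ κ') (cκ σ κ)
  | .nbeat κ' κ => .nbeat (cκ σ κ') (cκ σ κ)
  | .best κ => .best (cκ σ κ)
  | .orOk => .orOk
  | .ob κ b => .ob (cκ σ κ) b
  | .orBit b => .orBit b

/-- Relabelling a section-node shape. [folklore] -/
def AndGate.relabel (σ : Equiv.Perm (WV m)) : AndGate m → AndGate m
  | .nreach u w => .nreach (σ u) (σ w)
  | .partAt u U' => .partAt (σ u) (fs σ U')
  | .isPart U' => .isPart (fs σ U')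
  | .nisPart U' => .nisPart (fs σ U')
  | .imp U' => .imp (fs σ U')
  | .andOk => .andOk
  | .vc g => .vc (g.relabel σ)
  | .pg U' U'' u => .pg (fs σ U') (fs σ U'') (σ u)
  | .cntGe U' t => .cntGe (fs σ U') t
  | .ncntGe U' t => .ncntGe (fs σ U') t
  | .cntIs U' t => .cntIs (fs σ U') t
  | .eqp U' U'' => .eqp (fs σ U') (fs σ U'')
  | .multGe U' q => .multGe (fs σ U') q
  | .rowSrc i U' t => .rowSrc i (fs σ U') t
  | .pcb i c U' t o => .pcb i c (fs σ U') t o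
  | .pCol i c => .pCol i c
  | .scp i j U' t => .scp i j (fs σ U') t
  | .sameCopy i j => .sameCopy i j
  | .nsame i j => .nsame i j
  | .pab i j U' t o o' => .pab i j (fs σ U') t o o'
  | .pOwn i j => .pOwn i j
  | .swu c c' u w => .swu c c' (σ u) (σ w)
  | .swcc c c' => .swcc c c'
  | .xcp i j c c' => .xcp i j c c'
  | .xc i j => .xc i j
  | .pX i j => .pX i j
  | .pAdj i j => .pAdj i j

/-- **Relabelling a gate of the window canoniser** over a permutation `ρ` of `Fin m` acting as `σ` on the window type. [folklore] -/
def Gt.relabel (ρ : Equiv.Perm (Fin m)) (σ : Equiv.Perm (WV m)) : Gt m → Gt m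
  | .tt => .tt
  | .ff => .ff
  | .adjW u v => .adjW (σ u) (σ v)
  | .adjO u b => .adjO (σ u) (ρ b)
  | .sig g => .sig (g.relabel σ)
  | .root g => .root (g.relabel σ)
  | .an L k g => .an (FLab.relabel σ L) k (g.relabel σ)
  | .tr L k g => .tr (FLab.relabel σ L) k (g.relabel σ)
  | .vor L g => .vor (FLab.relabel σ L) (g.relabel σ)
  | .vand L g => .vand (FLab.relabel σ L) (g.relabel σ)
  | .vl L g => .vl (FLab.relabel σ L) g
  | .woc a b u c => .woc a (ρ b) (σ u) c
  | .out q => .out q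

/-! ### Relabelling by `σ⁻¹` undoes relabelling by `σ` -/

/-- Relabelling a `RIGate` by `σ⁻¹` undoes relabelling by `σ`. [folklore] -/
@[simp] theorem RIGate.relabel_symm_relabel (σ : Equiv.Perm (WV m)) (g : RIGate m) : (g.relabel σ).relabel σ.symm = g := by
  cases g <;> simp [RIGate.relabel]

/-- Relabelling a `VSGate` by `σ⁻¹` undoes relabelling by `σ`. [folklore] -/
@[simp] theorem VSGate.relabel_symm_relabel (σ : Equiv.Perm (WV m)) (g : VSGate m) : (g.relabel σ).relabel σ.symm = g := by
  cases g <;> simp [VSGate.relabel]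

/-- Relabelling a `VOGate` by `σ⁻¹` undoes relabelling by `σ`. [folklore] -/
@[simp] theorem VOGate.relabel_symm_relabel (σ : Equiv.Perm (WV m)) (g : VOGate m) : (g.relabel σ).relabel σ.symm = g := by
  cases g <;> simp [VOGate.relabel]

/-- Relabelling a `VAGate` by `σ⁻¹` undoes relabelling by `σ`. [folklore] -/
@[simp] theorem VAGate.relabel_symm_relabel (σ : Equiv.Perm (WV m)) (g : VAGate m) : (g.relabel σ).relabel σ.symm = g := by
  cases g <;> simp [VAGate.relabel]

/-- Relabelling a `AnGate` by `σ⁻¹` undoes relabelling by `σ`. [folklore] -/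
@[simp] theorem AnGate.relabel_symm_relabel (σ : Equiv.Perm (WV m)) (g : AnGate m) : (g.relabel σ).relabel σ.symm = g := by
  cases g <;> simp [AnGate.relabel]

/-- Relabelling a `TrGate` by `σ⁻¹` undoes relabelling by `σ`. [folklore] -/
@[simp] theorem TrGate.relabel_symm_relabel (σ : Equiv.Perm (WV m)) (g : TrGate m) : (g.relabel σ).relabel σ.symm = g := by
  cases g <;> simp [TrGate.relabel]

/-- Relabelling a `OrGate` by `σ⁻¹` undoes relabelling by `σ`. [folklore] -/
@[simp] theorem OrGate.relabel_symm_relabel (σ : Equiv.Perm (WV m)) (g : OrGate m) : (g.relabel σ).relabel σ.symm = g := by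
  cases g <;> simp [OrGate.relabel]

/-- Relabelling a `AndGate` by `σ⁻¹` undoes relabelling by `σ`. [folklore] -/
@[simp] theorem AndGate.relabel_symm_relabel (σ : Equiv.Perm (WV m)) (g : AndGate m) : (g.relabel σ).relabel σ.symm = g := by
  cases g <;> simp [AndGate.relabel]

/-- Relabelling a `Gt` by `σ⁻¹` undoes relabelling by `σ`. [folklore] -/
@[simp] theorem Gt.relabel_symm_relabel (ρ : Equiv.Perm (Fin m)) (σ : Equiv.Perm (WV m)) (g : Gt m) :
    (g.relabel ρ σ).relabel ρ.symm σ.symm = g := by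
  cases g <;> simp [Gt.relabel]

/-! ### … and conversely -/

/-- Relabelling a `RIGate` by `σ` undoes relabelling by `σ⁻¹`. [folklore] -/
@[simp] theorem RIGate.relabel_relabel_symm (σ : Equiv.Perm (WV m)) (g : RIGate m) : (g.relabel σ.symm).relabel σ = g := by
  simpa using RIGate.relabel_symm_relabel σ.symm g

/-- Relabelling a `VSGate` by `σ` undoes relabelling by `σ⁻¹`. [folklore] -/
@[simp] theorem VSGate.relabel_relabel_symm (σ : Equiv.Perm (WV m)) (g : VSGate m) : (g.relabel σ.symm).relabel σ = g := by
  simpa using VSGate.relabel_symm_relabel σ.symm g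

/-- Relabelling a `VOGate` by `σ` undoes relabelling by `σ⁻¹`. [folklore] -/
@[simp] theorem VOGate.relabel_relabel_symm (σ : Equiv.Perm (WV m)) (g : VOGate m) : (g.relabel σ.symm).relabel σ = g := by
  simpa using VOGate.relabel_symm_relabel σ.symm g

/-- Relabelling a `VAGate` by `σ` undoes relabelling by `σ⁻¹`. [folklore] -/
@[simp] theorem VAGate.relabel_relabel_symm (σ : Equiv.Perm (WV m)) (g : VAGate m) : (g.relabel σ.symm).relabel σ = g := by
  simpa using VAGate.relabel_symm_relabel σ.symm g

/-- Relabelling a `AnGate` by `σ` undoes relabelling by `σ⁻¹`. [folklore] -/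
@[simp] theorem AnGate.relabel_relabel_symm (σ : Equiv.Perm (WV m)) (g : AnGate m) : (g.relabel σ.symm).relabel σ = g := by
  simpa using AnGate.relabel_symm_relabel σ.symm g

/-- Relabelling a `TrGate` by `σ` undoes relabelling by `σ⁻¹`. [folklore] -/
@[simp] theorem TrGate.relabel_relabel_symm (σ : Equiv.Perm (WV m)) (g : TrGate m) : (g.relabel σ.symm).relabel σ = g := by
  simpa using TrGate.relabel_symm_relabel σ.symm g

/-- Relabelling a `OrGate` by `σ` undoes relabelling by `σ⁻¹`. [folklore] -/
@[simp] theorem OrGate.relabel_relabel_symm (σ : Equiv.Perm (WV m)) (g : OrGate m) : (g.relabel σ.symm).relabel σ = g := by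
  simpa using OrGate.relabel_symm_relabel σ.symm g

/-- Relabelling a `AndGate` by `σ` undoes relabelling by `σ⁻¹`. [folklore] -/
@[simp] theorem AndGate.relabel_relabel_symm (σ : Equiv.Perm (WV m)) (g : AndGate m) : (g.relabel σ.symm).relabel σ = g := by
  simpa using AndGate.relabel_symm_relabel σ.symm g

/-- Relabelling a `Gt` by `σ` undoes relabelling by `σ⁻¹`. [folklore] -/
@[simp] theorem Gt.relabel_relabel_symm (ρ : Equiv.Perm (Fin m)) (σ : Equiv.Perm (WV m)) (g : Gt m) :
    (g.relabel ρ.symm σ.symm).relabel ρ σ = g := by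
  simpa using Gt.relabel_symm_relabel ρ.symm σ.symm g

/-! ### The permutation of the gate type -/

/-- **The relabelling of the gates over `(ρ, σ)` as a permutation of the gate type** — the `θ ρ` of `SymProg.IsSym` /
`GraphProgram.θ`, to be used with `σ := budgetPerm ρ hρ`. [folklore] -/
def Gt.perm (ρ : Equiv.Perm (Fin m)) (σ : Equiv.Perm (WV m)) : Equiv.Perm (Gt m) where
  toFun := Gt.relabel ρ σ
  invFun := Gt.relabel ρ.symm σ.symm
  left_inv g := Gt.relabel_symm_relabel ρ σ g
  right_inv g := Gt.relabel_relabel_symm ρ σ g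

/-- `Gt.perm` acts as `Gt.relabel`. [folklore] -/
@[simp] theorem Gt.perm_apply (ρ : Equiv.Perm (Fin m)) (σ : Equiv.Perm (WV m)) (g : Gt m) : Gt.perm ρ σ g = g.relabel ρ σ := rfl

/-- The inverse acts as relabelling by the inverses. [folklore] -/
@[simp] theorem Gt.perm_symm_apply (ρ : Equiv.Perm (Fin m)) (σ : Equiv.Perm (WV m)) (g : Gt m) :
    (Gt.perm ρ σ).symm g = g.relabel ρ.symm σ.symm := rfl

/-- **The outputs are fixed** (`GraphProgram.out_fixed`). [folklore] -/
theorem Gt.perm_out (ρ : Equiv.Perm (Fin m)) (σ : Equiv.Perm (WV m)) (q : Fin m × Fin m) : Gt.perm ρ σ (.out q) = .out q := rfl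

/-- The symmetry data of the program: over a budget permutation, relabel by it and by its restriction to the window; elsewhere
(irrelevant) the identity. [folklore] -/
noncomputable def θw (m : ℕ) (ρ : Equiv.Perm (Fin m)) : Equiv.Perm (Gt m) :=
  open scoped Classical in
  if hρ : ρ ∈ Literature.Computability.Complexity.pointStabiliserBudget m (Nat.log 2 m) then Gt.perm ρ (budgetPerm ρ hρ)
  else Equiv.refl _

/-- On the budget, `θw` is `Gt.perm ρ (budgetPerm ρ hρ)`. [folklore] -/
theorem θw_eq {ρ : Equiv.Perm (Fin m)} (hρ : ρ ∈ Literature.Computability.Complexity.pointStabiliserBudget m (Nat.log 2 m)) :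
    θw m ρ = Gt.perm ρ (budgetPerm ρ hρ) := by
  unfold θw; rw [dif_pos hρ]

/-- `θw` fixes the outputs. [folklore] -/
theorem θw_out (ρ : Equiv.Perm (Fin m)) (q : Fin m × Fin m) : θw m ρ (.out q) = .out q := by
  unfold θw
  by_cases hρ : ρ ∈ Literature.Computability.Complexity.pointStabiliserBudget m (Nat.log 2 m)
  · rw [dif_pos hρ]; rfl
  · rw [dif_neg hρ]; rfl

end WCanon

end Summit.PneNP.PneNP.Theorems
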